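import Literature.IUT.HodgeTheaters.Cor53iFcircHBOfBrigidKummer
import Literature.AlgebraicGeometry.Frobenioids.ModelFrobenioidUnitAutTwist
import Literature.AlgebraicGeometry.Frobenioids.ArithmeticFrobenioidUnitProfinite
import Literature.AlgebraicGeometry.Frobenioids.ArithmeticDivisorsUnits
import Literature.AlgebraicGeometry.Frobenioids.DivisorialDescriptionsAPairs
import HarnessLib

/-!
# [IUTchI] Cor 5.3 (i) «resp. `⊚`»: the Galois-richness binder `hS` of ★ `Cor53.fcirc_rigidOverBase_of_galoisRich` is NECESSARY — the
# `hB⊚`-conclusion of ★ `Cor53.whisker_ratioRigid_of_iso_galoisRich` is FALSE at every CONSTANT whiskering (degenerate carrier, OURS)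

S. Mochizuki, *Inter-universal Teichmüller theory I*, kurims manuscript (May 2020), §5 Cor 5.3 (i) p. 144 l. 2–11 («resp. `†ℱ^⊚`»), proof l. 24–33;
Ex 5.1 (iii) pp. 125–126, (v) pp. 127–128 ([IUTchI] Cor 5.3 (i) p.144; Ex 5.1 (v) p.128) [claim: Mochizuki2012, status: disputed] (D-0012 claim key;
this file proves statements about the cell's typed carriers only; nothing of the series is asserted; no side taken on [IUTchIII] Cor. 3.12).
[FrdI]: S. Mochizuki, *The geometry of Frobenioids I*, Kyushu J. Math. **62** (2008), Thm 5.2 (i)/(ii) pp. 100–101, Ex 6.3 p. 113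
[cite: MochizukiFrdI2008, Thm. 5.2(i) p.100].

PROOF-ONLY NEGATIVE-KNOWLEDGE WITNESS (cell abc-iut, seat abc-iut-L5-t11 gen 19, row «HBCIRC-DEGENERATE-FACE», abc-iut-L5-lead gen 11 RULINGS #193 (1);
finding «HB⊚-DEGENERATE-CARRIER» = abc-iut-L5-t16 gen 13, STATUS 13:55:57Z (2), booked RULINGS #173 (3); 0 def / 0 instance / 0 notation / no Prop fact).
STATE OF RECORD: ★ p542877 `Cor53iFcircHBOfBrigidKummer` proves the 𝔹-RATIO law `hB⊚` in the `S`-whiskered currency and hence `hker⊚` under the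
DISPLAYED binder `hS` (the whiskering is isomorphic to a GALOIS-RICH one: (G1) cover, (G2) directed by inclusions, (G3) Galois arrows); abc-iut-L5-t4's
★ p545785 inhabits `hS` at the intended open-image induction carriers.  THIS FILE shows `hS` cannot be dropped:
* **`Cor53.not_whisker_ratioRigid_const F H K₀ A w`** — for EVERY number field `F`, profinite `H`, finite subextension `K₀ ⊆ F̄`, object `A` of `ℬ(H)⁰`
  and finite place `w` of `K₀`, the CONCLUSION of ★ `Cor53.whisker_ratioRigid_of_iso_galoisRich` is FALSE at the CONSTANT whiskering
  `S := (Functor.const (BaseCat H)).obj K₀` — abc-iut-L5-t16's recipe: the `Div`-compatible natural involution `σ(u) = u·(−1)^{ord_w u}` of `𝔹∘S = K₀^×`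
  (`Div(−1) = 0`, ★ `principalArithDivisor_eq_zero_iff`), its unit-automorphism twist `Ψ_σ` over `𝟭` (abc-iut-L1-t7 ★
  `ModelFrobenioid.exists_unitAutTwist_selfEquivalence`, [FrdI] Thm 5.2 (i)) and the parallel linear pair `f = (1, 𝟙_A, d′, π)`, `g = (1, 𝟙_A, d, 1) :
  (A, 0) → (A, [d])`, `ord_w π = 1` (`valuation_exists_uniformizer`, ★ `exp_neg_ordFin`); every pull-back along the constant `S` is the identity, so the
  ratio law for ANY `η` reads `σ(π)·1 = σ(1)·π`, i.e. `−π = π` in `K₀` — absurd in characteristic `0`;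
* **`Cor53.not_iso_galoisRich_const (hZ : IsSlimGroup H)`** / **`Cor53.not_galoisRich_of_iso_const`** — hence, for `H` slim, NO whiskering isomorphic to a
  constant one satisfies the `hS` ∃-binder of ★ `Cor53.fcirc_rigidOverBase_of_galoisRich` / CERT V25 BlocksI conjunct (a) (contrapositive of ★
  `Cor53.whisker_ratioRigid_of_iso_galoisRich`): `hS` is a GENUINE hypothesis, not idle padding.
HONEST TAGS: refutable-as-typed at OUR degenerate stand-in (a constant base morphism is NOT the intended `†𝒟^⊚ → †𝒟^⊛` = the open-image induction
of [IUTchI] Ex 5.1 (i)/(iii), ★ p545785) ≠ refuted in print; no token effect (count-neutral rider «hS NECESSARY» on the IUTchI:Cor5.3(i) ⊚-slot);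
typed ≠ inhabited ≠ proved; nothing here asserts abc proved or refuted.
-/

noncomputable section

set_option backward.isDefEq.respectTransparency false

namespace Literature.IUT.HodgeTheaters
open CategoryTheory Opposite NumberField Literature.AlgebraicGeometry.Frobenioids
open Literature.AlgebraicGeometry.Frobenioids.QuasiTemperoid

namespace Cor53
section DegenerateCarrier
variable (F : Type) [Field F] [NumberField F] (H : ProfiniteGrp.{0}) (K₀ : FinSubextCat F (Fbar F))

/-- A number field has an element of order exactly `1` at any finite place (a uniformizer; Mathlib `valuation_exists_uniformizer` read through
★ `exp_neg_ordFin`). [cite: MochizukiFrdI2008, Ex. 6.3 p.113] -/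
private theorem exists_ordFin_eq_one (L : Type) [Field L] [NumberField L] (w : FinitePlace L) : ∃ x : Lˣ, ordFin L w x = 1 := by
  obtain ⟨π, hπ⟩ := w.maximalIdeal.valuation_exists_uniformizer L
  have hne : π ≠ 0 := by rintro rfl; rw [map_zero] at hπ; exact WithZero.exp_ne_zero hπ.symm
  refine ⟨Units.mk0 π hne, ?_⟩
  have h := exp_neg_ordFin w (Units.mk0 π hne); rw [Units.val_mk0, hπ, WithZero.exp_inj] at h; omega

/-- **`hS` IS NECESSARY — the `hB⊚`-conclusion of ★ `Cor53.whisker_ratioRigid_of_iso_galoisRich` FAILS at every CONSTANT whiskering** `S ≡ K₀ :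
ℬ(H)⁰ → FinSubextCat F F̄` (any object `A` of `ℬ(H)⁰`, any finite place `w` of `K₀`): NOT every self-equivalence `Ψ` of the model of the whiskered data
`(Φ^⊛∘S, 𝔹∘S, Div∘S)` over the identity of `ℬ(H)⁰` admits an `η` with the unit-ratio law on parallel linear pairs — the unit-automorphism twist `Ψ_σ`,
`σ(u) = u·(−1)^{ord_w u}` ([FrdI] Thm 5.2 (i); abc-iut-L1-t7's construction), violates it at `f = (1, 𝟙, d′, π)`, `g = (1, 𝟙, d, 1)`, `ord_w π = 1`
(`−π = π`).  The negated statement is p542877's conclusion with `S := (Functor.const (BaseCat H)).obj K₀` (spelled through the `let`).  OUR witness at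
OUR stand-in; not a statement of either paper. ([IUTchI] Cor 5.3 (i) p.144; Ex 5.1 (v) p.128) [cite: MochizukiFrdI2008, Thm. 5.2(i) p.100]
[claim: Mochizuki2012, status: disputed] -/
theorem not_whisker_ratioRigid_const (A : BaseCat H) (w : FinitePlace K₀.L) :
    let S : BaseCat H ⥤ FinSubextCat F (Fbar F) := (Functor.const (BaseCat H)).obj K₀
    ¬ (∀ Ψ : (GlobalDivisorData.mk (S.op ⋙ arithDivisorFunctor F (Fbar F)) (S.op ⋙ unitsFunctor F (Fbar F))
        (Functor.whiskerLeft S.op (divNatTrans F (Fbar F))) : GlobalDivisorData H).ModelGlobalFrobenioid ≌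
      (GlobalDivisorData.mk (S.op ⋙ arithDivisorFunctor F (Fbar F)) (S.op ⋙ unitsFunctor F (Fbar F))
        (Functor.whiskerLeft S.op (divNatTrans F (Fbar F))) : GlobalDivisorData H).ModelGlobalFrobenioid,
      Nonempty (Ψ.functor ⋙ (GlobalDivisorData.mk (S.op ⋙ arithDivisorFunctor F (Fbar F)) (S.op ⋙ unitsFunctor F (Fbar F))
        (Functor.whiskerLeft S.op (divNatTrans F (Fbar F))) : GlobalDivisorData H).modelBase ≅
        (GlobalDivisorData.mk (S.op ⋙ arithDivisorFunctor F (Fbar F)) (S.op ⋙ unitsFunctor F (Fbar F))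
        (Functor.whiskerLeft S.op (divNatTrans F (Fbar F))) : GlobalDivisorData H).modelBase) →
      ∃ η : Ψ.functor ⋙ (GlobalDivisorData.mk (S.op ⋙ arithDivisorFunctor F (Fbar F)) (S.op ⋙ unitsFunctor F (Fbar F))
        (Functor.whiskerLeft S.op (divNatTrans F (Fbar F))) : GlobalDivisorData H).modelBase ≅
        (GlobalDivisorData.mk (S.op ⋙ arithDivisorFunctor F (Fbar F)) (S.op ⋙ unitsFunctor F (Fbar F))
        (Functor.whiskerLeft S.op (divNatTrans F (Fbar F))) : GlobalDivisorData H).modelBase,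
        ∀ ⦃X Y : (GlobalDivisorData.mk (S.op ⋙ arithDivisorFunctor F (Fbar F)) (S.op ⋙ unitsFunctor F (Fbar F))
        (Functor.whiskerLeft S.op (divNatTrans F (Fbar F))) : GlobalDivisorData H).ModelGlobalFrobenioid⦄ (f g : X ⟶ Y),
          ModelFrobenioid.degFr f = 1 → ModelFrobenioid.degFr g = 1 → ModelFrobenioid.baseMap f = ModelFrobenioid.baseMap g →
            ModelFrobenioid.unit (Ψ.functor.map f) *
                pull (S.op ⋙ unitsFunctor F (Fbar F)) (A := X.base) (B := (Ψ.functor.obj X).base) (η.hom.app X)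
                  (ModelFrobenioid.unit g) =
              ModelFrobenioid.unit (Ψ.functor.map g) *
                pull (S.op ⋙ unitsFunctor F (Fbar F)) (A := X.base) (B := (Ψ.functor.obj X).base) (η.hom.app X)
                  (ModelFrobenioid.unit f)) := by
  intro S hrat
  have hpull : ∀ {A₁ A₂ : BaseCat H} (a : A₂ ⟶ A₁) (u : (S.op ⋙ unitsFunctor F (Fbar F)).obj (op A₁)),
      pull (S.op ⋙ unitsFunctor F (Fbar F)) a u = u := fun _ _ => Units.ext rfl
  have hneg1 : ordFin K₀.L w (-1) = 0 := by
    have h := ordFin_pow w (-1) 2; rw [neg_one_sq, ordFin_one] at h; omega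
  -- the involution `σ(u) = u · (−1)^{ord_w u}` of `K₀^×`, as a `Div`-compatible natural automorphism of the constant `𝔹 ∘ S`
  let χ : (K₀.L)ˣ →* (K₀.L)ˣ :=
    { toFun := fun u => u * (-1) ^ ordFin K₀.L w u
      map_one' := by rw [ordFin_one, zpow_zero, mul_one]
      map_mul' := fun u v => by
        show u * v * (-1) ^ ordFin K₀.L w (u * v) = u * (-1) ^ ordFin K₀.L w u * (v * (-1) ^ ordFin K₀.L w v)
        rw [ordFin_mul, zpow_add, mul_mul_mul_comm] }
  have hχ : ∀ u : (K₀.L)ˣ, χ u = u * (-1) ^ ordFin K₀.L w u := fun u => rfl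
  have hχχ : ∀ u : (K₀.L)ˣ, χ (χ u) = u := fun u => by
    rw [hχ, hχ, ordFin_mul, ordFin_zpow, hneg1, mul_zero, add_zero, mul_assoc, ← zpow_add, ← two_mul, zpow_mul,
      zpow_two, neg_mul_neg, one_mul, one_zpow, mul_one]
  let τ : (K₀.L)ˣ ≃* (K₀.L)ˣ := { toFun := χ, invFun := χ, left_inv := hχχ, right_inv := hχχ, map_mul' := χ.map_mul }
  have hmap : ∀ {X₁ X₂ : (BaseCat H)ᵒᵖ} (a : X₁ ⟶ X₂), (S.op ⋙ unitsFunctor F (Fbar F)).map a = 𝟙 _ := fun a => (unitsFunctor F (Fbar F)).map_id _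
  let σ : (S.op ⋙ unitsFunctor F (Fbar F)) ≅ (S.op ⋙ unitsFunctor F (Fbar F)) :=
    NatIso.ofComponents (fun _ => τ.toCommMonCatIso) (fun a => by rw [hmap, Category.id_comp, Category.comp_id])
  have hσ_app : ∀ (A₁ : BaseCat H) (u : (K₀.L)ˣ), (σ.hom.app (op A₁)).hom u = χ u := fun _ _ => rfl
  have hdivtors : ∀ (A₁ : BaseCat H) (x : (K₀.L)ˣ), IsOfFinOrder x →
      divB (S.op ⋙ arithDivisorFunctor F (Fbar F)) (S.op ⋙ unitsFunctor F (Fbar F))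
        (Functor.whiskerLeft S.op (divNatTrans F (Fbar F))) (op A₁) x = 1 := fun A₁ x hx => by
    change divB (arithDivisorFunctor F (Fbar F)) (unitsFunctor F (Fbar F)) (divNatTrans F (Fbar F)) (op K₀) x = 1
    rwa [arith_divB_eq_one_iff, principalArithDivisor_eq_zero_iff]
  have htors : ∀ n : ℤ, IsOfFinOrder ((-1 : (K₀.L)ˣ) ^ n) := fun n => (isOfFinOrder_iff_pow_eq_one.mpr ⟨2, two_pos, neg_one_sq⟩).zpow
  have hσ : ∀ (A₁ : BaseCat H) (u : (S.op ⋙ unitsFunctor F (Fbar F)).obj (op A₁)),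
      divB (S.op ⋙ arithDivisorFunctor F (Fbar F)) (S.op ⋙ unitsFunctor F (Fbar F))
          (Functor.whiskerLeft S.op (divNatTrans F (Fbar F))) (op A₁) ((σ.hom.app (op A₁)).hom u) =
        divB (S.op ⋙ arithDivisorFunctor F (Fbar F)) (S.op ⋙ unitsFunctor F (Fbar F))
          (Functor.whiskerLeft S.op (divNatTrans F (Fbar F))) (op A₁) u := fun A₁ u => by
    rw [hσ_app A₁ u, hχ, map_mul, hdivtors A₁ _ (htors _), mul_one]
  -- the unit-automorphism twist `Ψ_σ` over the identity ([FrdI] Thm 5.2 (i); abc-iut-L1-t7)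
  obtain ⟨Ψ, η, -, -, hunit, -, -⟩ := ModelFrobenioid.exists_unitAutTwist_selfEquivalence σ hσ
  obtain ⟨η', hlaw⟩ := hrat Ψ ⟨η⟩
  -- a uniformizer `π` at `w` and effective divisors `d, d′` with `[d′] = [d] · Div π`
  obtain ⟨π, hπ⟩ := exists_ordFin_eq_one K₀.L w
  obtain ⟨d', d, hd⟩ := PreFrobenioid.exists_eq_of_div_of
    (divB (S.op ⋙ arithDivisorFunctor F (Fbar F)) (S.op ⋙ unitsFunctor F (Fbar F))
      (Functor.whiskerLeft S.op (divNatTrans F (Fbar F))) (op A) π)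
  -- the parallel linear pair `f = (1, 𝟙, d′, π)`, `g = (1, 𝟙, d, 1) : (A, 0) ⟶ (A, [d])`
  let X₀ : (GlobalDivisorData.mk (S.op ⋙ arithDivisorFunctor F (Fbar F)) (S.op ⋙ unitsFunctor F (Fbar F))
      (Functor.whiskerLeft S.op (divNatTrans F (Fbar F))) : GlobalDivisorData H).ModelGlobalFrobenioid := ⟨A, 1⟩
  let Y₀ : (GlobalDivisorData.mk (S.op ⋙ arithDivisorFunctor F (Fbar F)) (S.op ⋙ unitsFunctor F (Fbar F))
      (Functor.whiskerLeft S.op (divNatTrans F (Fbar F))) : GlobalDivisorData H).ModelGlobalFrobenioid :=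
    ⟨A, Algebra.GrothendieckGroup.of d⟩
  let f : X₀ ⟶ Y₀ := ModelFrobenioid.mkHom X₀ Y₀ 1 (𝟙 A) d' π (by
    show (1 : Algebra.GrothendieckGroup _) ^ ((1 : ℕ+) : ℕ) * Algebra.GrothendieckGroup.of d' =
      pullGp (S.op ⋙ arithDivisorFunctor F (Fbar F)) (𝟙 A) (Algebra.GrothendieckGroup.of d) *
        divB (S.op ⋙ arithDivisorFunctor F (Fbar F)) (S.op ⋙ unitsFunctor F (Fbar F))
          (Functor.whiskerLeft S.op (divNatTrans F (Fbar F))) (op A) π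
    rw [one_pow, one_mul, pullGp_id, hd, mul_comm, div_mul_cancel])
  let g : X₀ ⟶ Y₀ := ModelFrobenioid.mkHom X₀ Y₀ 1 (𝟙 A) d 1 (by
    show (1 : Algebra.GrothendieckGroup _) ^ ((1 : ℕ+) : ℕ) * Algebra.GrothendieckGroup.of d =
      pullGp (S.op ⋙ arithDivisorFunctor F (Fbar F)) (𝟙 A) (Algebra.GrothendieckGroup.of d) *
        divB (S.op ⋙ arithDivisorFunctor F (Fbar F)) (S.op ⋙ unitsFunctor F (Fbar F))
          (Functor.whiskerLeft S.op (divNatTrans F (Fbar F))) (op A) 1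
    rw [one_pow, one_mul, pullGp_id, map_one, mul_one])
  have key := hlaw f g rfl rfl rfl
  -- the four entries of the law in `K₀^×` (pull-backs along the constant `S` are identities); then `σ(π)·1 = σ(1)·π`, i.e. `−π = π`: absurd
  have h1 : ModelFrobenioid.unit (Ψ.functor.map f) = χ π := by
    rw [hunit]; exact (hpull (η.hom.app X₀) _).trans (hσ_app X₀.base (ModelFrobenioid.unit f))
  have h2 : ModelFrobenioid.unit (Ψ.functor.map g) = χ 1 := by
    rw [hunit]; exact (hpull (η.hom.app X₀) _).trans (hσ_app X₀.base (ModelFrobenioid.unit g))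
  have h3 : pull (S.op ⋙ unitsFunctor F (Fbar F)) (A := X₀.base) (B := (Ψ.functor.obj X₀).base) (η'.hom.app X₀)
      (ModelFrobenioid.unit g) = (1 : (K₀.L)ˣ) := hpull _ _
  have h4 : pull (S.op ⋙ unitsFunctor F (Fbar F)) (A := X₀.base) (B := (Ψ.functor.obj X₀).base) (η'.hom.app X₀)
      (ModelFrobenioid.unit f) = π := hpull _ _
  have final : χ π * (1 : (K₀.L)ˣ) = χ 1 * π := by
    rw [← h1, ← h2, ← h3]
    conv_rhs => rw [← h4]
    exact key
  rw [χ.map_one, mul_one, one_mul, hχ, hπ, zpow_one] at final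
  have hval : ((π * (-1 : (K₀.L)ˣ) : (K₀.L)ˣ) : K₀.L) = (π : K₀.L) := congrArg Units.val final
  rw [Units.val_mul, Units.val_neg, Units.val_one, mul_neg_one] at hval
  have h2 : (2 : K₀.L) * (π : K₀.L) = 0 := by linear_combination -hval
  exact (mul_eq_zero.mp h2).elim two_ne_zero π.ne_zero

/-- **Hence, for `H` slim, the CONSTANT whiskering is NOT isomorphic to a Galois-rich one**: the displayed binder `hS` ((G1), (G2), (G3) up to
isomorphism of whiskerings) of ★ `Cor53.fcirc_rigidOverBase_of_galoisRich` / ★ `Cor53.whisker_ratioRigid_of_iso_galoisRich` FAILS at `S ≡ K₀` — else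
that theorem would give the ratio law refuted above; so `hS` is a GENUINE hypothesis of the `⊚`-slot closers (inhabited at the intended induction carriers,
abc-iut-L5-t4's ★ p545785; empty at this degenerate stand-in).  OUR bookkeeping. ([IUTchI] Cor 5.3 (i) p.144; Ex 5.1 (v) p.128)
[cite: MochizukiFrdI2008, Thm. 5.2(ii) p.101] [claim: Mochizuki2012, status: disputed] -/
theorem not_iso_galoisRich_const (hZ : IsSlimGroup H) (A : BaseCat H) (w : FinitePlace K₀.L) :
    ¬ ∃ (S' : BaseCat H ⥤ FinSubextCat F (Fbar F)) (c₀ : BaseCat H) (_ : (Functor.const (BaseCat H)).obj K₀ ≅ S'),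
      (∀ u : Fbar F, ∃ c : BaseCat H, u ∈ (S'.obj c).L) ∧ (∀ c₁ c₂ : BaseCat H, ∃ (c₃ : BaseCat H) (g₁ : c₃ ⟶ c₁) (g₂ : c₃ ⟶ c₂),
        (∀ y : (S'.obj c₁).L, (((S'.map g₁).toAlgHom y : (S'.obj c₃).L) : Fbar F) = y) ∧
        (∀ y : (S'.obj c₂).L, (((S'.map g₂).toAlgHom y : (S'.obj c₃).L) : Fbar F) = y)) ∧
      (∀ (σ : Fbar F ≃ₐ[(S'.obj c₀).L] Fbar F) (u : Fbar F), ∃ (c c' : BaseCat H) (g : c' ⟶ c),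
        u ∈ (S'.obj c).L ∧ ∀ y : (S'.obj c).L, (((S'.map g).toAlgHom y : (S'.obj c').L) : Fbar F) = σ y) :=
  fun hS => not_whisker_ratioRigid_const F H K₀ A w
    (whisker_ratioRigid_of_iso_galoisRich ((Functor.const (BaseCat H)).obj K₀) hZ hS)

/-- … and so does every whiskering ISOMORPHIC to a constant one (e.g. the record form `(𝓕.baseMor ⋙ 𝓕.identify.functor) ⋙ galoisSubextOfFinite F` of a
global Frobenioid `𝓕` with constant base morphism `†𝒟^⊚ → †𝒟^⊛`): the `hS` ∃-binder of ★ `Cor53.fcirc_rigidOverBase_of_galoisRich` is EMPTY there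
(isomorphisms compose).  OUR bookkeeping. ([IUTchI] Cor 5.3 (i) p.144) [cite: MochizukiFrdI2008, Thm. 5.2(ii) p.101] [claim: Mochizuki2012, status: disputed] -/
theorem not_galoisRich_of_iso_const (hZ : IsSlimGroup H) (A : BaseCat H) (w : FinitePlace K₀.L) {S : BaseCat H ⥤ FinSubextCat F (Fbar F)}
    (e : S ≅ (Functor.const (BaseCat H)).obj K₀) :
    ¬ ∃ (S' : BaseCat H ⥤ FinSubextCat F (Fbar F)) (c₀ : BaseCat H) (_ : S ≅ S'),
      (∀ u : Fbar F, ∃ c : BaseCat H, u ∈ (S'.obj c).L) ∧ (∀ c₁ c₂ : BaseCat H, ∃ (c₃ : BaseCat H) (g₁ : c₃ ⟶ c₁) (g₂ : c₃ ⟶ c₂),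
        (∀ y : (S'.obj c₁).L, (((S'.map g₁).toAlgHom y : (S'.obj c₃).L) : Fbar F) = y) ∧
        (∀ y : (S'.obj c₂).L, (((S'.map g₂).toAlgHom y : (S'.obj c₃).L) : Fbar F) = y)) ∧
      (∀ (σ : Fbar F ≃ₐ[(S'.obj c₀).L] Fbar F) (u : Fbar F), ∃ (c c' : BaseCat H) (g : c' ⟶ c),
        u ∈ (S'.obj c).L ∧ ∀ y : (S'.obj c).L, (((S'.map g).toAlgHom y : (S'.obj c').L) : Fbar F) = σ y) :=
  fun ⟨S', c₀, φ, h⟩ => not_iso_galoisRich_const F H K₀ hZ A w ⟨S', c₀, e.symm ≪≫ φ, h⟩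

end DegenerateCarrier
end Cor53

end Literature.IUT.HodgeTheaters

end
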